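import Summits.QuantumFields.QCD.Theses.HeatSlicedQuarks
import Summits.QuantumFields.QCD.Theorems.QuarkLoopCoefficient.Negative.LoadBearing
import Summits.QuantumFields.QCD.Theorems.QuarkLoopCoefficient.Negative.TimeCap

/-!
# Disproof work file — crux `QuarkLoopCoefficient` (stmt-QuantumFields-16786, route HeatSlicedQuarks)

Refuter seat `refuter-cdisprove-stmt-QuantumFields-16786-0`, cycle 1 (2026-08-17).

## Findings (index)

* §0 `QLCWith κ` — the crux with a general main-term coefficient `κ·(1 − cos θ)`;
  `quarkLoopCoefficient_iff : QuarkLoopCoefficient ↔ QLCWith (1/(3π²))`.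
* §1 `fluxConfig L` — a Lean-certified GENUINE inhabitant of the three structural hypotheses for every
  `L`: Cartan-diagonal links `U(y,1) = diag(ω^{y₀}, ω^{−y₀}, 1)`, `ω = e^{2πi/L}`, all other links `1`;
  plaquette `(0,1)` is the constant `diag(e^{iθ_L}, e^{−iθ_L}, 1)` with `θ_L = 2π/L` (flux quantum `k = L`,
  no wrap row needed), every other plaquette is `1` (`fluxConfig_cartan/flux/flat`).  For `L = s² ≥ 49` the point
  `(θ, t) = (2π/s², s)` lies in the crux window (`window_seq`), so the hypotheses are NOT vacuous and
  are met by non-flat fields at every large `L` (the flat torons of the 17986 refutation have `θ = 0`).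
* §2 `quarkLoopCoefficient_false_without_flux` — dropping the flux hypothesis (H₂) decouples `θ` from `U`;
  the trivial field with `θ = 2π/s²`, `t = s`, `L = s²` kills it: the main term `(1 − cos θ)/(3π²) ≍ θ²` is NOT
  absorbable in the envelope `Cθ²(1/t + θ²t²) + Ce^{−cL²/(t+L)}/t² = o(θ²)` along this sequence
  (`envelope_small`).  Any proof must use H₂ (obvious, but it certifies that the envelope does not swallow the claim).
* §3 `qlcWith_unique : QLCWith κ → QLCWith κ' → κ = κ'` — COEFFICIENT RIGIDITY: along the genuine flux
  configurations of §1 the envelope is `o(1 − cos θ)`, so at most ONE coefficient makes the crux shape true.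
  Corollary `quarkLoopCoefficient_pins_coefficient : QuarkLoopCoefficient → κ ≠ 1/(3π²) → ¬ QLCWith κ`.
  Consequence for K1 (kill criterion of the route): the numerics test THE statement — a measured plateau
  `κ_latt ≠ 1/(3π²)` would refute the crux as typed, not merely re-tune a constant.
* §4 `quarkLoopCoefficient_false_without_timeCap` — dropping `t ≤ L²`: the one-site flat toron (`θ = 0`, sibling
  toolkit `TracedQuadraticParametrix/Negative/FalseWithoutRLeL`) has deficit `8 − 8e^{−4t} ≥ 4` for all `t ≥ 1` against
  an allowance `Ce^{−c/(t+1)}/t² → 0`; in the crux the cap makes the image allowance `≍ C/L⁴` at `t = L²`, the zero-mode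
  scale — the finite-volume tail is sharp in `t` as well as in `L`.
* LANDED: §0–§3 as `Theorems/QuarkLoopCoefficient/Negative/LoadBearing.lean` (p143518 ACCEPTED @ cba2c67cf471), §4 as
  `Theorems/QuarkLoopCoefficient/Negative/TimeCap.lean` (p143519 ACCEPTED @ c8cd5455b33f); both `--supports stmt-QuantumFields-16786`.
* NOT load-bearing / not refutable (information for the prover, docstring-level): Cartan-diagonality H₁ (gauge
  covariance of the traced diagonal; every field with these plaquettes should be gauge-equivalent to a Cartan one);
  the cap `t|θ| ≤ 1` (outside it the allowance `θ⁴t²` is ≥ a constant times everything the left side can be, GIVEN a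
  window bound `|K_U| ≤ C'(θ/t + 1/t²)`-type estimate — so dropping it only moves work, it does not falsify);
  `0 < c` (with `c = 0` the claim follows from the window bound `|K_U(x,x)| ≤ C/t²`); `1 ≤ t` (only guards `t ≤ 0`
  junk: for `0 < t ≤ 1` the allowance `Cθ²/t` dominates).  Fixed-`L` degenerate tori (`L = 1, 2, 3`) cannot refute:
  for fixed `L` the left side is `≤ 25` and the right side is `≥ C·min((2π/L²)⁴, e^{−cL}/L⁴) > 0`, so only `L → ∞`
  families bite; the `2π`-periodicity of H₂ in `θ` cannot be exploited because `t|θ| ≤ 1`, `t ≥ 1` force `|θ| ≤ 1`.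
* WHY IT RESISTS (physics, for the provers): per charged colour the continuum traced kernel is
  `(4/(16π²t²))·(θt)coth(θt) = 4/(16π²t²) + θ²/(12π²) − θ⁴t²/(180π²) + …`; two charged colours give exactly
  `θ²/(6π²) = [(1 − cos θ)/(3π²)]_{θ²}` (the universal one-loop quark `b₀` coefficient) and the Landau remainder
  `−θ⁴t²/(90π²)` inside `Cθ⁴t²`; the lattice correction to the `θ²` coefficient is a Laplace expansion of Brillouin-zone
  integrals of trigonometric polynomials against `e^{−th(p)}`, `h` analytic with a unique non-degenerate zero, hence a
  log-free series in `1/t` (no `O(a) = t^{−1/2}` term at `m = 0`: single-γ insertions die in the spin trace); images sit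
  inside the proved U-uniform Davies–Gaffney envelope once the on-diagonal `t⁻²` is supplied by ultracontractivity in the
  window.
* NUMERICS (this seat, kit j023130 `t ≤ 64` + j023250 `t = 96, 128, 192`; RESULTS.md on the item): infinite-volume
  Landau-chain reduction of the FULL traced kernel (validated against the 4D Brillouin-zone sum to 1e-8): `6π²g(t) =
  0.9248, 0.9534, 0.9734, 0.9857, 0.9925, 0.9962, 0.9974, 0.9981, 0.9987` at `t = 2, 4, 8, 16, 32, 64, 96, 128, 192`;
  `t·(1 − 6π²g) = 0.150 → 0.2486 ↗ 1/4` while `t·deficit/log t ↘ 0.047` — a LOG-FREE `1/t` artefact matching the lead's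
  `12π²e2 = 1 − 1/(4t) + 3/(8t²)` to `2.7e-5` (t = 32), `≤ 4e-6` (t ≥ 96, numerical floor); Landau regime: `t(ΔK_latt − ΔK_cont)/θ²` converges at fixed `θt` (uniform `O(θ²/t)` on `θt ≤ 1` on top of
  the continuum `coth` function, which carries the `θ⁴t²`); envelope ratio `(ΔK − main)/(θ²(1/t + θ²t²)) ∈ [−0.0043, −0.0011]` on `2 ≤ t ≤ 192`
  (the crux holds in infinite volume with `C ≈ 0.005`).  No numerical handle against the crux.  Earlier: j020890/j020932
  (planner, tori, 2 %), j021094/j021156 (17986 refuter, Bloch cells, 0.5 %).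

Prose lives in docstrings; everything conclusive is `sorry`-free and LANDED under `Theorems/QuarkLoopCoefficient/Negative/`
(`LoadBearing.lean` p143518 @ cba2c67cf471, `TimeCap.lean` p143519 @ c8cd5455b33f); this work file imports those modules and
re-exposes the results by one-line aliases (§A), so that ideators / planners / the lead can `import` either.  New attacks of later
cycles are appended below §A.
-/

noncomputable section

namespace Summit.QuantumFields.QCD.Cruxes.QuarkLoopCoefficient.Disproof

open Literature.MathematicalPhysics.QuantumLattice Literature.MathematicalPhysics.QuantumFieldTheory
open Literature.Probability.LatticeModels (Site TorusSite)
open Summit.QuantumFields.QCD.Theses.HeatSlicedQuarks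
open Summit.QuantumFields.QCD.Theorems.QuarkLoopCoefficient.Negative
open scoped Matrix ComplexConjugate

/-! ### §A Landed results (aliases of `Theorems/QuarkLoopCoefficient/Negative/{LoadBearing,TimeCap}.lean`) -/

/-- §0: the crux is `QLCWith (1/(3π²))`. -/
theorem crux_iff : QuarkLoopCoefficient ↔ QLCWith (1 / (3 * Real.pi ^ 2)) := quarkLoopCoefficient_iff

/-- §1 (non-vacuity, genuine flux): for every `s ≥ 7` the field `fluxConfig (s*s)` satisfies the three structural
hypotheses H₁–H₃ of the crux with `θ = 2π/(s*s)`, and `(t, θ) = (s, 2π/s²)` is inside the window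
`1 ≤ t ≤ L²`, `t|θ| ≤ 1`. -/
theorem hypotheses_inhabited {s : ℕ} (hs : 7 ≤ s) :
    haveI : NeZero (s * s) := ⟨by positivity⟩
    (∀ (e : Edge 4 (s * s)) (i j : Fin 3), i ≠ j → (fundamentalRep (Fin 3)) (fluxConfig (s * s) e) i j = 0) ∧
    (∀ y : TorusSite 4 (s * s), (fundamentalRep (Fin 3)) (plaquetteHolonomy (fluxConfig (s * s)) y 0 1) =
        Matrix.diagonal ![Complex.exp (Complex.I * ((2 * Real.pi / ((s * s : ℕ) : ℝ) : ℝ) : ℂ)),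
          Complex.exp (-(Complex.I * ((2 * Real.pi / ((s * s : ℕ) : ℝ) : ℝ) : ℂ))), 1]) ∧
    (∀ (y : TorusSite 4 (s * s)) (μ ν : Fin 4), ¬(μ = 0 ∧ ν = 1) → ¬(μ = 1 ∧ ν = 0) →
        plaquetteHolonomy (fluxConfig (s * s)) y μ ν = 1) ∧
    ((1 : ℝ) ≤ (s : ℝ) ∧ (s : ℝ) ≤ (((s * s : ℕ) : ℝ)) ^ 2 ∧ (s : ℝ) * |2 * Real.pi / ((s * s : ℕ) : ℝ)| ≤ 1) := by
  haveI : NeZero (s * s) := ⟨by positivity⟩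
  obtain ⟨h1, h2, h3, _⟩ := window_seq hs
  exact ⟨fluxConfig_cartan (s * s), fluxConfig_flux (s * s), fluxConfig_flat (s * s), h1, h2, h3⟩

/-- §2: the flux hypothesis H₂ is load-bearing. -/
theorem false_without_flux : ¬ QuarkLoopCoefficientWithoutFlux := quarkLoopCoefficient_false_without_flux

/-- §3: coefficient rigidity — at most one main-term coefficient fits the crux shape. -/
theorem coefficient_unique {κ κ' : ℝ} (hκ : QLCWith κ) (hκ' : QLCWith κ') : κ = κ' := qlcWith_unique hκ hκ'

/-- §3 (corollary): the crux excludes every other coefficient. -/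
theorem pins_coefficient (h : QuarkLoopCoefficient) {κ : ℝ} (hκ : κ ≠ 1 / (3 * Real.pi ^ 2)) : ¬ QLCWith κ :=
  quarkLoopCoefficient_pins_coefficient h hκ

/-- §4: the time cap `t ≤ L²` is load-bearing. -/
theorem false_without_timeCap : ¬ QuarkLoopCoefficientWithoutTimeCap := quarkLoopCoefficient_false_without_timeCap

/-! ### §B Line `Sketch` (lead prover-line-stmt-QuantumFields-16786-0): stub audit, cycle 1

No stub of the registered skeleton `Lines/Sketch.lean` was found false or mis-typed on reading (docstring record, no
theorem): `WindowBound` (true by 8871 + diagonal monotonicity: in the window the LLL weight `θ/(8π²t) ≤ 1/(8π²t²)`);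
`FreeMajorantToolkit` (1)–(6) (checked (3) moment absorption and (6) image sum by hand; (2) mixed convolution scales
correctly at `w = 0`, `a = b`); `FreeHeatCalculus` (6) IBP identity `t·(z_νĥ)∗k_t + w_νk_t = 0` verified in Fourier
variables; `TorusToPlane` (structural, exponential-series periodization, `|c_n| = 1` by magnetic translation
covariance); `GaussianMajorant` (Grönwall budget `∫₀ᵗ(θ²(1+s)+|θ|)ds ≤ 3c₀²/2 + c₀` is bounded in the core window —
consistent); `SecondOrderExpansion` (single-colour symbol is EVEN in `θ` by charge conjugation `Cγ_μᵀC⁻¹ = γ_μ`, so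
`a₁ = a₃ = 0` is admissible; remainder scale `θ⁴t²` is the continuum Landau scaling); `SecondOrderCoefficient`
(log-free `1/t` by Laplace asymptotics of analytic Brillouin-zone integrands with the unique non-degenerate zero of `h`).
Joint sufficiency is kernel-checked (`QuarkLoopCoefficient_of` has no `sorry`).  Independent numerics of the two
analytic stubs from the FULL kernel (not from `e2`): kit j023123, see NOTES.md / item evidence. -/

end Summit.QuantumFields.QCD.Cruxes.QuarkLoopCoefficient.Disproof
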